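import Summits.QuantumFields.YangMills.Theorems.AlphaInputsT3ACv3AvgIterLocality
import Summits.QuantumFields.YangMills.Theorems.AlphaInputsT3ACv3NewtonDefectMap
import Summits.QuantumFields.YangMills.Theorems.AlphaInputsT3ACv3EMLIterFirstOrderUniformAllL
import Literature.MathematicalPhysics.QuantumFieldTheory.Balaban1983to89.T3DescentFibreTower
import HarnessLib

/-!
# `AlphaInputsT3ACv3StartDefectCore` — START v3 row (S6), THE CORE: **the `k`-fold (0.4) defect `Ū^{(k)}(c)·V(c)*` at ONE coarse bond is controlled by ANY gauge that is
# `δ`-flat on a stencil containing the two `k`-blocks of `c`** — gauge covariance of the defect (★w4 `NewtonDefectMap`) + the stencil locality of `avg^k` (★alpha-2 g6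
# `AvgIterLocality`, (r4)) + the every-`L` flat-background bound R1 (★w5 `EMLIterUniformAllL`) — lane `pub-balaban3d` ∕ cell `ym3-torus`, seat alpha-2 (g6)

WHY (★w1-19936 g2 LEAD memo `NONABELIAN-FL-START-w1-g2.md` §3 (D) ∕ §4 row (S6)).  The START `U⁰` of the regional Newton lift has to enter the shell with a `k`-FREE defect
`η₀ = sup_{c ∈ bondsIn k Ω} ‖avg^k(U⁰)(c)·V(c)* − 1‖ = O(ε)`.  The LEAD's argument: the two cells of `c` carry no corner-line plaquette, so a comb-axial gauge `σ_c` on the two-cell box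
makes `(U⁰)^{σ_c}` `δ`-close to `1` there (`δ = O(ε L^{−k})`); R1 (flat background, every `L`) then gives `avg^k((U⁰)^{σ_c})(c) = 1 + O((d+1)L^k δ) = 1 + O(ε)` PROVIDED the average at `c`
reads the box only — the (r4) locality; the section `W₀` is flat on the box, so in ITS box gauge `σ⁰_c` it is `≡ 1` there and `V(c) = avg^k W₀(c) = σ⁰_c(ĉ₋)⁻¹σ⁰_c(ĉ₊)`; the two gauges
compared at the centres `ĉ_±` differ by `1 + O(ε)` (tube ∕ ball crossings).  THIS FILE is that argument with the box facts left as HYPOTHESES (they are (S2)∕(S5)'s), so that (S6) proper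
is an instantiation: no object of START v3 is needed here, and every estimate is by name.
WHAT (def-free; `SU(n)`, the exp-mean-log average `expMeanLogSU` of record, standing range `k ≤ m + K`, every `L ≥ 2`).
* §1 ★ `norm_iter_sub_one_le_of_localFlat` — if `‖U(b) − 1‖ ≤ δ` on the finest bonds with both ends in a set `S ⊇ B^k(c₋) ∪ B^k(c₊)` (nothing asked elsewhere), then
  `‖avg^k U(c) − 1‖ ≤ 2(d+1)L^kδ` under R1's three smallness rows at `δ` (cut `U` off to `1` outside `S`, `AvgIterLocality.iter_blockAvg_congr₂_of_blocks_subset`, R1-allL).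
* §2 ★★ `norm_defect_sub_one_le_of_localGauge` — for ANY finest gauge `σ` with `‖U^σ(b) − 1‖ ≤ δ` on the `S`-bonds and `‖σ^{(k)}(c₋)V(c)σ^{(k)}(c₊)⁻¹ − 1‖ ≤ τ`:
  `‖avg^k U(c)·V(c)* − 1‖ ≤ 2(d+1)L^kδ + τ + 2(d+1)L^kδ·τ` (`NewtonDefectMap.norm_defect_gaugeAct_sub_one` + §1).
* §3 ★ `iter_eq_of_localTrivial` — if `W^σ ≡ 1` on the `S`-bonds then `avg^k W(c) = σ^{(k)}(c₋)⁻¹·σ^{(k)}(c₊)` EXACTLY (locality + `M^k(1) = 1`); ★★ `norm_defect_sub_one_le_of_twoGauges` —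
  the (D) shape: `U` `δ`-flat on `S` in the gauge `σ`, `W` trivial on `S` in the gauge `σ⁰`, `V(c) := avg^k W(c)`, and the two gauges compared at the centres,
  `‖σ^{(k)}(c₋)σ⁰^{(k)}(c₋)⁻¹σ⁰^{(k)}(c₊)σ^{(k)}(c₊)⁻¹ − 1‖ ≤ τ` ⇒ `‖avg^k U(c)·(avg^k W(c))* − 1‖ ≤ 2(d+1)L^kδ + τ + 2(d+1)L^kδ·τ`.
HONEST FRAMING.  Kernel bookkeeping over landed theorems; the START `U⁰`, its box gauges and the tube∕ball sup letters are NOT here ((S2)∕(S5)); count-neutral helper toward the (FL)∕KIN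
row `hLift` of R3 2′∕2′χ (`stub_laneRecordsV3`, items 19935∕19936 — NOT proved here); registry untouched; nothing about d = 4, the continuum limit, or a mass gap; YM₃ on T³ is rung
R3, not the Clay problem.

References: T. Bałaban, Commun. Math. Phys. 98 (1985) 17–51 [Balaban1985Averaging] ((11)–(13) p.19, (19)–(21) p.21, Prop. 4 (134)–(135) p.38); CMP 109 (1987) 249–301
[Balaban1987RG1] ((0.4)+(0.11) p.253); CMP 102 (1985) 277–309 [Balaban1985Variational] ((8), (11)–(14) pp.279–280).
-/

set_option autoImplicit false

noncomputable section

open scoped Matrix.Norms.L2Operator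
open NormedSpace

namespace Summit.QuantumFields.YangMills.Theorems.StartDefectCore

open Literature.MathematicalPhysics.QuantumFieldTheory.Balaban1983to89
open T4Continuum BlockAveraging ExpMeanLog BlockAveragingEMLLinearised
open Literature.MathematicalPhysics.QuantumFieldTheory.Balaban1983to89.T3DescentFibreTower (avgFun_one expMeanLogSU_E_one)
open Literature.MathematicalPhysics.QuantumFieldTheory.Balaban1983to89.B5Eq118OneStroke (iterBlockOf)
open Summit.QuantumFields.YangMills.Theorems.LinearLiftMatrix (linAvgIterM linAvgIterM_zero linAvgIterM_succ)
open Summit.QuantumFields.YangMills.Theorems.EMLIterUniformAllL (norm_iter_sub_one_sub_iterLin_le_uniform_allL)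
open Summit.QuantumFields.YangMills.Theorems.NewtonDefectMap (norm_defect_gaugeAct_sub_one)
open Summit.QuantumFields.YangMills.Theorems.CovLinAvgFrame (coe_gaugeAct)
open Summit.QuantumFields.YangMills.Theorems.Prop7HolRatioPerStep (coe_star_mul_self coe_mul_star_self)
open Summit.QuantumFields.YangMills.Theorems.AvgIterLocality (iter_blockAvg_congr₂_of_blocks_subset)

variable {n : Type*} [Fintype n] [DecidableEq n] [Nonempty n] {P : Params}

/-! ## §0 `M^k(1) = 1` for the average of record, every index type -/

/-- The trivial configuration is a fixed point of `(blockAvg expMeanLogSU)^k` (one step: `avgFun_one` with `expMeanLogSU_E_one`). [cite: Balaban1987RG1, (0.4) p.253] -/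
theorem iter_blockAvg_expMeanLogSU_one (k : ℕ) :
    Averaging.iter (fun i => (blockAvg (expMeanLogSU (n := n)) : Averaging P i (Matrix.specialUnitaryGroup n ℂ))) k 1 = 1 := by
  induction k with
  | zero => rfl
  | succ k ih =>
    show (blockAvg (expMeanLogSU (n := n))).avg
        (Averaging.iter (fun i => (blockAvg (expMeanLogSU (n := n)) : Averaging P i (Matrix.specialUnitaryGroup n ℂ))) k 1) = 1
    rw [ih, blockAvg_avg]
    exact avgFun_one (expMeanLogSU (n := n)) expMeanLogSU_E_one

/-! ## §1 A field that is `δ`-flat on a stencil of `c` has `avg^k(c)` within `2(d+1)L^kδ` of `1` -/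

/-- **★ LOCAL R1**: if `‖U(b) − 1‖ ≤ δ` on every finest bond with both endpoints in a set `S` containing the two `k`-blocks of the level-`k` bond `c` — nothing is asked of `U` elsewhere —
then `‖avg^k U(c) − 1‖ ≤ 2(d+1)L^kδ`, under the three every-`L` smallness rows of R1 at `δ` (`C'·(d+1)L^kδ ≤ 1`, `32ℓ(d+1)L^kδ ≤ 1`, `4ℓ(d+1)L^kδ < δ_N`, `ℓ = (d+2)L`).  Proof: the field
`U'` equal to `U` on the `S`-bonds and `1` elsewhere is `δ`-flat on the whole torus, R1-allL bounds `avg^k U'(c)`, and `avg^k U'(c) = avg^k U(c)` by the stencil locality (r4).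
[cite: Balaban1985Averaging, Prop. 4 (134) p.38; Balaban1987RG1, (0.4) p.253] -/
theorem norm_iter_sub_one_le_of_localFlat {k : ℕ} (hk : k ≤ P.m + P.K) (U : GaugeField P 0 (Matrix.specialUnitaryGroup n ℂ))
    (S : Set (Site P 0)) (c : PBond P k) (hc : ∀ x : Site P 0, (iterBlockOf k x = c.src ∨ iterBlockOf k x = c.tgt) → x ∈ S)
    {δ : ℝ} (hδ : 0 ≤ δ) (hU : ∀ b : PBond P 0, b.src ∈ S → b.tgt ∈ S → ‖((U b : Matrix.specialUnitaryGroup n ℂ) : Matrix n n ℂ) - 1‖ ≤ δ)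
    (hm : (((P.d : ℝ) + 1) * ((18 : ℝ) ^ P.d * (2 + ((P.d : ℝ) + 1) * (18 : ℝ) ^ P.d)) * (324 * (((P.d + 2) * P.L : ℕ) : ℝ) ^ 2) /
        ((P.L : ℝ) * ((P.L : ℝ) - 1))) * (((P.d : ℝ) + 1) * (P.L : ℝ) ^ k * δ) ≤ 1)
    (h32 : 32 * (((P.d + 2) * P.L : ℕ) : ℝ) * (((P.d : ℝ) + 1) * (P.L : ℝ) ^ k * δ) ≤ 1)
    (hN : 4 * (((P.d + 2) * P.L : ℕ) : ℝ) * (((P.d : ℝ) + 1) * (P.L : ℝ) ^ k * δ) < deltaSU n) :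
    ‖((Averaging.iter (fun i => (blockAvg (expMeanLogSU (n := n)) : Averaging P i (Matrix.specialUnitaryGroup n ℂ))) k U c :
        Matrix.specialUnitaryGroup n ℂ) : Matrix n n ℂ) - 1‖ ≤ 2 * (((P.d : ℝ) + 1) * (P.L : ℝ) ^ k * δ) := by
  classical
  -- the cut-off field: `U` on the bonds inside `S`, `1` elsewhere
  let U' : GaugeField P 0 (Matrix.specialUnitaryGroup n ℂ) := fun b => if b.src ∈ S ∧ b.tgt ∈ S then U b else 1
  have hU' : ∀ b : PBond P 0, ‖((U' b : Matrix.specialUnitaryGroup n ℂ) : Matrix n n ℂ) - 1‖ ≤ δ := by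
    intro b
    by_cases hb : b.src ∈ S ∧ b.tgt ∈ S
    · simp only [U', if_pos hb]; exact hU b hb.1 hb.2
    · simp only [U', if_neg hb]
      rw [OneMemClass.coe_one, sub_self, norm_zero]; exact hδ
  have hloc : Averaging.iter (fun i => (blockAvg (expMeanLogSU (n := n)) : Averaging P i (Matrix.specialUnitaryGroup n ℂ))) k U c =
      Averaging.iter (fun i => (blockAvg (expMeanLogSU (n := n)) : Averaging P i (Matrix.specialUnitaryGroup n ℂ))) k U' c :=
    iter_blockAvg_congr₂_of_blocks_subset (expMeanLogSU (n := n)) hk S (fun b h1 h2 => by simp only [U', if_pos (And.intro h1 h2)]) c hc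
  have hQ0 : ∀ Y : PBond P 0 → Matrix n n ℂ, linAvgIterM 0 Y = Y := fun Y => linAvgIterM_zero Y
  have hQs : ∀ (i : ℕ) (Y : PBond P 0 → Matrix n n ℂ) (c : PBond P (i + 1)), linAvgIterM (i + 1) Y c = linAvg (linAvgIterM i Y) c :=
    fun i Y c => linAvgIterM_succ i Y c
  have hR1 := norm_iter_sub_one_sub_iterLin_le_uniform_allL linAvgIterM hQ0 hQs U' hδ hU' k hk hm h32 hN
  rw [hloc]
  exact (hR1 k le_rfl c).1

/-! ## §2 The defect against a datum in any gauge that is `δ`-flat on the stencil -/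

omit [DecidableEq n] [Nonempty n] in
/-- Algebra: `‖X·Y* − 1‖ ≤ ‖X − 1‖ + ‖Y − 1‖ + ‖X − 1‖·‖Y − 1‖` for matrices (`‖Y*‖`-isometry of the operator norm). [folklore] -/
theorem norm_mul_star_sub_one_le [DecidableEq n] (X Y : Matrix n n ℂ) :
    ‖X * star Y - 1‖ ≤ ‖X - 1‖ + ‖Y - 1‖ + ‖X - 1‖ * ‖Y - 1‖ := by
  have e : X * star Y - 1 = (X - 1) + star (Y - 1) + (X - 1) * star (Y - 1) := by
    rw [star_sub, star_one]; noncomm_ring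
  rw [e]
  calc ‖(X - 1) + star (Y - 1) + (X - 1) * star (Y - 1)‖ ≤ ‖X - 1‖ + ‖star (Y - 1)‖ + ‖(X - 1) * star (Y - 1)‖ := norm_add₃_le
    _ ≤ ‖X - 1‖ + ‖Y - 1‖ + ‖X - 1‖ * ‖Y - 1‖ := by
        have h1 : ‖star (Y - 1)‖ = ‖Y - 1‖ := norm_star _
        have h2 : ‖(X - 1) * star (Y - 1)‖ ≤ ‖X - 1‖ * ‖Y - 1‖ := (norm_mul_le _ _).trans (by rw [h1])
        rw [h1]; linarith

/-- **★★ THE DEFECT IN ANY LOCALLY FLAT GAUGE** (`k ≤ m + K`): for a finest gauge `σ` with `‖U^σ(b) − 1‖ ≤ δ` on the bonds inside a set `S ⊇ B^k(c₋) ∪ B^k(c₊)` and a datum `V` with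
`‖σ^{(k)}(c₋)·V(c)·σ^{(k)}(c₊)⁻¹ − 1‖ ≤ τ` (`σ^{(k)} = transfUp σ k`, the gauge read at the `k`-centres), the defect at `c` obeys `‖avg^k U(c)·V(c)* − 1‖ ≤ 2(d+1)L^kδ + τ + 2(d+1)L^kδ·τ`
under R1's rows at `δ`: the defect norm is gauge invariant (`NewtonDefectMap.norm_defect_gaugeAct_sub_one`), and in the gauge `σ` the average is within `2(d+1)L^kδ` of `1` by §1.
[cite: Balaban1985Averaging, (11)–(13) p.19, (19)–(21) p.21, Prop. 4 (134) p.38] -/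
theorem norm_defect_sub_one_le_of_localGauge {k : ℕ} (hk : k ≤ P.m + P.K) (U : GaugeField P 0 (Matrix.specialUnitaryGroup n ℂ))
    (V : GaugeField P k (Matrix.specialUnitaryGroup n ℂ)) (σ : GaugeTransf P 0 (Matrix.specialUnitaryGroup n ℂ))
    (S : Set (Site P 0)) (c : PBond P k) (hc : ∀ x : Site P 0, (iterBlockOf k x = c.src ∨ iterBlockOf k x = c.tgt) → x ∈ S)
    {δ τ : ℝ} (hδ : 0 ≤ δ)
    (hUσ : ∀ b : PBond P 0, b.src ∈ S → b.tgt ∈ S → ‖((GaugeField.gaugeAct σ U b : Matrix.specialUnitaryGroup n ℂ) : Matrix n n ℂ) - 1‖ ≤ δ)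
    (hV : ‖((GaugeField.gaugeAct (transfUp σ k) V c : Matrix.specialUnitaryGroup n ℂ) : Matrix n n ℂ) - 1‖ ≤ τ)
    (hm : (((P.d : ℝ) + 1) * ((18 : ℝ) ^ P.d * (2 + ((P.d : ℝ) + 1) * (18 : ℝ) ^ P.d)) * (324 * (((P.d + 2) * P.L : ℕ) : ℝ) ^ 2) /
        ((P.L : ℝ) * ((P.L : ℝ) - 1))) * (((P.d : ℝ) + 1) * (P.L : ℝ) ^ k * δ) ≤ 1)
    (h32 : 32 * (((P.d + 2) * P.L : ℕ) : ℝ) * (((P.d : ℝ) + 1) * (P.L : ℝ) ^ k * δ) ≤ 1)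
    (hN : 4 * (((P.d + 2) * P.L : ℕ) : ℝ) * (((P.d : ℝ) + 1) * (P.L : ℝ) ^ k * δ) < deltaSU n) :
    ‖((Averaging.iter (fun i => (blockAvg (expMeanLogSU (n := n)) : Averaging P i (Matrix.specialUnitaryGroup n ℂ))) k U c :
        Matrix.specialUnitaryGroup n ℂ) : Matrix n n ℂ) * star ((V c : Matrix.specialUnitaryGroup n ℂ) : Matrix n n ℂ) - 1‖ ≤
      2 * (((P.d : ℝ) + 1) * (P.L : ℝ) ^ k * δ) + τ + 2 * (((P.d : ℝ) + 1) * (P.L : ℝ) ^ k * δ) * τ := by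
  rw [← norm_defect_gaugeAct_sub_one (fun i => (blockAvg (expMeanLogSU (n := n)) : Averaging P i (Matrix.specialUnitaryGroup n ℂ))) σ hk U V c]
  have hX := norm_iter_sub_one_le_of_localFlat hk (GaugeField.gaugeAct σ U) S c hc hδ hUσ hm h32 hN
  set X := ((Averaging.iter (fun i => (blockAvg (expMeanLogSU (n := n)) : Averaging P i (Matrix.specialUnitaryGroup n ℂ))) k (GaugeField.gaugeAct σ U) c :
        Matrix.specialUnitaryGroup n ℂ) : Matrix n n ℂ)
  set Y := ((GaugeField.gaugeAct (transfUp σ k) V c : Matrix.specialUnitaryGroup n ℂ) : Matrix n n ℂ)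
  have hm0 : 0 ≤ 2 * (((P.d : ℝ) + 1) * (P.L : ℝ) ^ k * δ) := by positivity
  have hτ0 : 0 ≤ τ := (norm_nonneg _).trans hV
  calc ‖X * star Y - 1‖ ≤ ‖X - 1‖ + ‖Y - 1‖ + ‖X - 1‖ * ‖Y - 1‖ := norm_mul_star_sub_one_le X Y
    _ ≤ 2 * (((P.d : ℝ) + 1) * (P.L : ℝ) ^ k * δ) + τ + 2 * (((P.d : ℝ) + 1) * (P.L : ℝ) ^ k * δ) * τ :=
        add_le_add (add_le_add hX hV) (mul_le_mul hX hV (norm_nonneg _) hm0)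

/-! ## §3 The flat side: a field trivial on the stencil in some gauge has EXACT averages; the two-gauge form of (D) -/

/-- **★ EXACT AVERAGES OF A LOCALLY TRIVIALISABLE FIELD** (`k ≤ m + K`): if `W^σ(b) = 1` on every finest bond with both endpoints in `S ⊇ B^k(c₋) ∪ B^k(c₊)`, then
`avg^k W(c) = σ^{(k)}(c₋)⁻¹·σ^{(k)}(c₊)` — in the gauge `σ` the field is `1` on the stencil, its average at `c` is `M^k(1)(c) = 1` by locality, and `avg^k(W^σ) = (avg^k W)^{σ^{(k)}}`.
(The section `W₀ = iterSec V` on the two cells of a bond of `bondsIn k Ω` is this situation.) [cite: Balaban1985Averaging, (11)–(13) p.19; Balaban1987RG1, (0.4) p.253] -/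
theorem iter_eq_of_localTrivial {k : ℕ} (hk : k ≤ P.m + P.K) (W : GaugeField P 0 (Matrix.specialUnitaryGroup n ℂ))
    (σ : GaugeTransf P 0 (Matrix.specialUnitaryGroup n ℂ)) (S : Set (Site P 0)) (c : PBond P k)
    (hc : ∀ x : Site P 0, (iterBlockOf k x = c.src ∨ iterBlockOf k x = c.tgt) → x ∈ S)
    (hW : ∀ b : PBond P 0, b.src ∈ S → b.tgt ∈ S → GaugeField.gaugeAct σ W b = 1) :
    Averaging.iter (fun i => (blockAvg (expMeanLogSU (n := n)) : Averaging P i (Matrix.specialUnitaryGroup n ℂ))) k W c =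
      (transfUp σ k c.src)⁻¹ * transfUp σ k c.tgt := by
  have h1 : Averaging.iter (fun i => (blockAvg (expMeanLogSU (n := n)) : Averaging P i (Matrix.specialUnitaryGroup n ℂ))) k (GaugeField.gaugeAct σ W) c = 1 := by
    rw [iter_blockAvg_congr₂_of_blocks_subset (expMeanLogSU (n := n)) hk S (U' := 1) (fun b h1 h2 => hW b h1 h2) c hc, iter_blockAvg_expMeanLogSU_one]
    rfl
  rw [iter_gaugeAct _ σ k hk W] at h1
  -- `h1 : σk(c₋) · avg^k W(c) · σk(c₊)⁻¹ = 1`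
  have h2 : transfUp σ k c.src * Averaging.iter (fun i => (blockAvg (expMeanLogSU (n := n)) : Averaging P i (Matrix.specialUnitaryGroup n ℂ))) k W c *
      (transfUp σ k c.tgt)⁻¹ = 1 := h1
  calc Averaging.iter (fun i => (blockAvg (expMeanLogSU (n := n)) : Averaging P i (Matrix.specialUnitaryGroup n ℂ))) k W c
      = (transfUp σ k c.src)⁻¹ * (transfUp σ k c.src * Averaging.iter (fun i => (blockAvg (expMeanLogSU (n := n)) : Averaging P i (Matrix.specialUnitaryGroup n ℂ))) k W c *
          (transfUp σ k c.tgt)⁻¹) * transfUp σ k c.tgt := by group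
    _ = (transfUp σ k c.src)⁻¹ * transfUp σ k c.tgt := by rw [h2, mul_one]

/-- **★★ THE (D) SHAPE — TWO GAUGES COMPARED AT THE CENTRES** (`k ≤ m + K`): `U` is `δ`-flat on the stencil `S ⊇ B^k(c₋) ∪ B^k(c₊)` in the gauge `σ`, `W` is trivial on `S` in the gauge
`σ⁰`, the datum is `V(c) := avg^k W(c)`, and `‖σ^{(k)}(c₋)·σ⁰^{(k)}(c₋)⁻¹·σ⁰^{(k)}(c₊)·σ^{(k)}(c₊)⁻¹ − 1‖ ≤ τ` (for gauges based at `ĉ₋` this is `‖t(ĉ₊)⁻¹ − 1‖`, `t = σσ⁰⁻¹`).  Then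
`‖avg^k U(c)·(avg^k W(c))* − 1‖ ≤ 2(d+1)L^kδ + τ + 2(d+1)L^kδ·τ` under R1's rows at `δ` — the START defect `η₀` at `c`, `k`-free as soon as `L^kδ` and `τ` are.
[cite: Balaban1985Averaging, (11)–(13) p.19, (19)–(21) p.21, Prop. 4 (134) p.38; Balaban1985Variational, (11)–(14) pp.279–280] -/
theorem norm_defect_sub_one_le_of_twoGauges {k : ℕ} (hk : k ≤ P.m + P.K) (U W : GaugeField P 0 (Matrix.specialUnitaryGroup n ℂ))
    (σ σ₀ : GaugeTransf P 0 (Matrix.specialUnitaryGroup n ℂ)) (S : Set (Site P 0)) (c : PBond P k)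
    (hc : ∀ x : Site P 0, (iterBlockOf k x = c.src ∨ iterBlockOf k x = c.tgt) → x ∈ S)
    {δ τ : ℝ} (hδ : 0 ≤ δ)
    (hUσ : ∀ b : PBond P 0, b.src ∈ S → b.tgt ∈ S → ‖((GaugeField.gaugeAct σ U b : Matrix.specialUnitaryGroup n ℂ) : Matrix n n ℂ) - 1‖ ≤ δ)
    (hW : ∀ b : PBond P 0, b.src ∈ S → b.tgt ∈ S → GaugeField.gaugeAct σ₀ W b = 1)
    (hτ : ‖((transfUp σ k c.src * (transfUp σ₀ k c.src)⁻¹ * transfUp σ₀ k c.tgt * (transfUp σ k c.tgt)⁻¹ : Matrix.specialUnitaryGroup n ℂ) : Matrix n n ℂ) - 1‖ ≤ τ)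
    (hm : (((P.d : ℝ) + 1) * ((18 : ℝ) ^ P.d * (2 + ((P.d : ℝ) + 1) * (18 : ℝ) ^ P.d)) * (324 * (((P.d + 2) * P.L : ℕ) : ℝ) ^ 2) /
        ((P.L : ℝ) * ((P.L : ℝ) - 1))) * (((P.d : ℝ) + 1) * (P.L : ℝ) ^ k * δ) ≤ 1)
    (h32 : 32 * (((P.d + 2) * P.L : ℕ) : ℝ) * (((P.d : ℝ) + 1) * (P.L : ℝ) ^ k * δ) ≤ 1)
    (hN : 4 * (((P.d + 2) * P.L : ℕ) : ℝ) * (((P.d : ℝ) + 1) * (P.L : ℝ) ^ k * δ) < deltaSU n) :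
    ‖((Averaging.iter (fun i => (blockAvg (expMeanLogSU (n := n)) : Averaging P i (Matrix.specialUnitaryGroup n ℂ))) k U c :
        Matrix.specialUnitaryGroup n ℂ) : Matrix n n ℂ) *
      star ((Averaging.iter (fun i => (blockAvg (expMeanLogSU (n := n)) : Averaging P i (Matrix.specialUnitaryGroup n ℂ))) k W c :
        Matrix.specialUnitaryGroup n ℂ) : Matrix n n ℂ) - 1‖ ≤
      2 * (((P.d : ℝ) + 1) * (P.L : ℝ) ^ k * δ) + τ + 2 * (((P.d : ℝ) + 1) * (P.L : ℝ) ^ k * δ) * τ := by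
  set V : GaugeField P k (Matrix.specialUnitaryGroup n ℂ) :=
    Averaging.iter (fun i => (blockAvg (expMeanLogSU (n := n)) : Averaging P i (Matrix.specialUnitaryGroup n ℂ))) k W with hVdef
  have hVc : V c = (transfUp σ₀ k c.src)⁻¹ * transfUp σ₀ k c.tgt := by
    rw [hVdef]; exact iter_eq_of_localTrivial hk W σ₀ S c hc hW
  refine norm_defect_sub_one_le_of_localGauge hk U V σ S c hc hδ hUσ ?_ hm h32 hN
  -- the datum in the gauge `σ`: `σk(c₋)·V(c)·σk(c₊)⁻¹ = σk(c₋)σ₀k(c₋)⁻¹σ₀k(c₊)σk(c₊)⁻¹`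
  have e : GaugeField.gaugeAct (transfUp σ k) V c = transfUp σ k c.src * (transfUp σ₀ k c.src)⁻¹ * transfUp σ₀ k c.tgt * (transfUp σ k c.tgt)⁻¹ := by
    show transfUp σ k c.src * V c * (transfUp σ k c.tgt)⁻¹ = _
    rw [hVc]; group
  rw [e]; exact hτ

end Summit.QuantumFields.YangMills.Theorems.StartDefectCore

end
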